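import Summits.FinalStateConjecture.FinalStateConjecture.Theses.MergerLatticeBudget

/-!
# Route MergerLatticeBudget — `KerrIrreducibleMassBounds` (support item stmt-FinalStateConjecture-10234)

Closes the route decl
`Summit.FinalStateConjecture.FinalStateConjecture.Theses.MergerLatticeBudget.KerrIrreducibleMassBounds`:
for `0 < M` and `|a| ≤ M`, with the outer horizon radius `r₊ = M + √(M² − a²)`
(`Literature.Geometry.Lorentzian.Kerr.rPlus`),

* `M r₊ / 2 ≤ M²` (i.e. `m_irr² ≤ M²`, Christodoulou–Ruffini `M ≥ m_irr`),
* `M² ≤ M r₊` (i.e. `M² ≤ 2 m_irr²`, extraction `≤ (1 − 1/√2) M`),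
* `0 ≤ M² − a²`.

Elementary real arithmetic: `0 ≤ √(M² − a²) ≤ √(M²) = M`.
Sources: Christodoulou–Ruffini, Phys. Rev. D 4 (1971) 3552; Wald 1984 §12.4.
-/

namespace Summit.FinalStateConjecture.FinalStateConjecture.Theorems

open Literature.Geometry.Lorentzian

/-- For `|a| ≤ M` the discriminant `M² − a²` is nonnegative. [folklore] -/
theorem kerr_sq_sub_sq_nonneg {M a : ℝ} (ha : |a| ≤ M) : 0 ≤ M ^ 2 - a ^ 2 := by
  have h1 : -M ≤ a := (abs_le.1 ha).1
  have h2 : a ≤ M := (abs_le.1 ha).2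
  nlinarith

/-- For `0 ≤ M`: `√(M² − a²) ≤ M`. [folklore] -/
theorem kerr_sqrt_sq_sub_sq_le {M : ℝ} (a : ℝ) (hM : 0 ≤ M) : √(M ^ 2 - a ^ 2) ≤ M := by
  have h1 : √(M ^ 2 - a ^ 2) ≤ √(M ^ 2) := Real.sqrt_le_sqrt (by nlinarith [sq_nonneg a])
  rwa [Real.sqrt_sq hM] at h1

/-- **Christodoulou–Ruffini bounds in `(M, a)` form.** For `0 < M`, `|a| ≤ M` and
`r₊ = M + √(M² − a²)`: `M r₊ / 2 ≤ M² ≤ M r₊` and `0 ≤ M² − a²` — i.e. `m_irr² = M r₊ / 2 ≤ M² ≤ 2 m_irr²`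
(Christodoulou–Ruffini 1971; Wald 1984 §12.4). Closes item stmt-FinalStateConjecture-10234.
[cite: Wald1984, §12.4] -/
theorem kerrIrreducibleMassBounds_proof :
    Summit.FinalStateConjecture.FinalStateConjecture.Theses.MergerLatticeBudget.KerrIrreducibleMassBounds := by
  unfold Summit.FinalStateConjecture.FinalStateConjecture.Theses.MergerLatticeBudget.KerrIrreducibleMassBounds
  intro M a hM ha
  have hs0 : 0 ≤ √(M ^ 2 - a ^ 2) := Real.sqrt_nonneg _
  have hsM : √(M ^ 2 - a ^ 2) ≤ M := kerr_sqrt_sq_sub_sq_le a hM.le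
  refine ⟨?_, ?_, kerr_sq_sub_sq_nonneg ha⟩
  · unfold Kerr.rPlus
    nlinarith
  · unfold Kerr.rPlus
    nlinarith

end Summit.FinalStateConjecture.FinalStateConjecture.Theorems
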